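import Literature.Analysis.FluidPDE.ClassicalL2Stability

/-! # The `H¹` interpolation inequality `(∫|∇f|²)² ≤ 9 ∫‖f‖² ∫‖D²f‖²` —
crux stmt-NavierStokesRegularity-0727 (`CertifiedBlowup.CertifiedBlowupAxisymBlowup`), line
`compact-amplification`, stub `stub_h1_interp`

PROVED, exactly as registered: there is an absolute constant `K ≥ 0` (here `K = 9`) such that for
every `C²` field `f : ℝ³ → ℝ³` with `f, D¹f, D²f ∈ L²`,
`(∫ |∇f|²)² ≤ K (∫ ‖f‖²) (∫ ‖D²f‖²)`, all three integrals being lower Lebesgue integrals and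
`|∇f|² = frobeniusNormSq (Df)`.

**Proof.** Green's identity for one field, `∫ Σᵢ ⟪∂ᵢf, ∂ᵢf⟫ = -∫ ⟪Δf, f⟫`
(`Literature.Analysis.FluidPDE.integral_sum_inner_fderiv_fderiv_eq_neg_integral_inner_laplacian`,
whose `L¹` side conditions follow from `f, Df, D²f ∈ L²`), the identity `Σᵢ ‖Df eᵢ‖² = |∇f|²`,
Cauchy–Schwarz (`Literature.Analysis.FluidPDE.integral_norm_mul_norm_le_sqrt_mul_sqrt`) and the
pointwise bound `‖Δf‖ ≤ 3 ‖D²f‖`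
(`Literature.Analysis.FluidPDE.norm_laplacian_le_three_mul_norm_iteratedFDeriv_two`) give, in `ℝ`,
`(∫|∇f|²)² ≤ (∫‖Δf‖²)(∫‖f‖²) ≤ 9 (∫‖f‖²)(∫‖D²f‖²)`; the finiteness hypotheses convert the three
lower Lebesgue integrals into `ENNReal.ofReal` of the corresponding Bochner integrals.
-/

set_option linter.dupNamespace false

noncomputable section

open MeasureTheory Set Function Filter Topology
open scoped ENNReal NNReal ContDiff

namespace Summit.NavierStokesRegularity.NavierStokesRegularity.Theorems.CertifiedBlowupAxisymBlowup.CompactAmplification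

open Literature.Analysis.FluidPDE InnerProductSpace
open scoped RealInnerProductSpace Laplacian

local notation "ℝ³" => EuclideanSpace ℝ (Fin 3)

/-- `∫⁻ ‖Δf‖ₑ² < ∞` for a `C²` field with `D²f ∈ L²` (pointwise `‖Δf‖ ≤ 3 ‖D²f‖`). -/
theorem h1_interp_lintegral_laplacian_lt_top {f : ℝ³ → ℝ³} (hf : ContDiff ℝ 2 f)
    (h2 : (∫⁻ x, ‖iteratedFDeriv ℝ 2 f x‖ₑ ^ 2) < ⊤) : (∫⁻ x, ‖(Δ f) x‖ₑ ^ 2) < ⊤ := by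
  refine lintegral_enorm_sq_lt_top_of_norm_le (b := fun x => (3 : ℝ) • iteratedFDeriv ℝ 2 f x)
    (fun x => ?_) (lintegral_enorm_sq_const_smul_lt_top 3 h2)
  rw [norm_smul, Real.norm_of_nonneg (by norm_num : (0 : ℝ) ≤ 3)]
  exact norm_laplacian_le_three_mul_norm_iteratedFDeriv_two hf x

/-- Green's identity for one field: `∫ |∇f|² = -∫ ⟪Δf, f⟫` for a `C²` field `f` with
`f, D¹f, D²f ∈ L²` (the products `∂ᵢ∂ᵢf · f`, `∂ᵢf · ∂ᵢf`, `∂ᵢf · f` are then in `L¹`). -/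
theorem h1_interp_green {f : ℝ³ → ℝ³} (hf : ContDiff ℝ 2 f) (h0 : (∫⁻ x, ‖f x‖ₑ ^ 2) < ⊤)
    (h1 : (∫⁻ x, ‖iteratedFDeriv ℝ 1 f x‖ₑ ^ 2) < ⊤)
    (h2 : (∫⁻ x, ‖iteratedFDeriv ℝ 2 f x‖ₑ ^ 2) < ⊤) :
    ∫ x, frobeniusNormSq (fderiv ℝ f x) = - ∫ x, ⟪(Δ f) x, f x⟫ := by
  set e := EuclideanSpace.basisFun (Fin 3) ℝ with he
  have hf1 : ContDiff ℝ 1 f := hf.of_le (by norm_num)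
  have cf : Continuous f := hf.continuous
  have cDf : Continuous (fderiv ℝ f) := hf.continuous_fderiv (by norm_num)
  have cdi : ∀ i, Continuous fun x => fderiv ℝ f x (e i) := fun i =>
    cDf.clm_apply continuous_const
  have cddi : ∀ i, Continuous fun x => fderiv ℝ (fun y => fderiv ℝ f y (e i)) x (e i) := fun i =>
    ((((hf.fderiv_right (m := 1) (by norm_num)).clm_apply contDiff_const).continuous_fderiv
      (by norm_num)).clm_apply continuous_const)
  have l2di : ∀ i, (∫⁻ x, ‖fderiv ℝ f x (e i)‖ₑ ^ 2) < ⊤ := fun i =>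
    lintegral_enorm_sq_lt_top_of_norm_le (fun x => norm_fderiv_apply_basisFun_le f x i) h1
  have l2ddi : ∀ i, (∫⁻ x, ‖fderiv ℝ (fun y => fderiv ℝ f y (e i)) x (e i)‖ₑ ^ 2) < ⊤ := fun i =>
    lintegral_enorm_sq_lt_top_of_norm_le (fun x => norm_fderiv_fderiv_apply_basisFun_le hf x i) h2
  have i1 : ∀ i, Integrable (fun x => ⟪fderiv ℝ (fun y => fderiv ℝ f y (e i)) x (e i), f x⟫)
      volume := fun i =>
    integrable_of_norm_le_mul_of_lintegral_sq ((cddi i).inner cf).aestronglyMeasurable (cddi i) cf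
      (l2ddi i) h0 fun x => norm_inner_le_norm _ _
  have i2 : ∀ i, Integrable (fun x => ⟪fderiv ℝ f x (e i), fderiv ℝ f x (e i)⟫) volume := fun i =>
    integrable_of_norm_le_mul_of_lintegral_sq ((cdi i).inner (cdi i)).aestronglyMeasurable
      (cdi i) (cdi i) (l2di i) (l2di i) fun x => norm_inner_le_norm _ _
  have i3 : ∀ i, Integrable (fun x => ⟪fderiv ℝ f x (e i), f x⟫) volume := fun i =>
    integrable_of_norm_le_mul_of_lintegral_sq ((cdi i).inner cf).aestronglyMeasurable (cdi i) cf
      (l2di i) h0 fun x => norm_inner_le_norm _ _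
  have hG := integral_sum_inner_fderiv_fderiv_eq_neg_integral_inner_laplacian hf hf1 i1 i2 i3
  have hsum : ∫ x, ∑ i, ⟪fderiv ℝ f x (e i), fderiv ℝ f x (e i)⟫ =
      ∫ x, frobeniusNormSq (fderiv ℝ f x) := by
    refine integral_congr_ae (Eventually.of_forall fun x => ?_)
    simp only
    rw [frobeniusNormSq_eq_sum e]
    exact Finset.sum_congr rfl fun i _ => real_inner_self_eq_norm_sq _
  rw [← hsum, hG]

/-- The interpolation inequality in `ℝ`: `(∫ |∇f|²)² ≤ 9 (∫ ‖f‖²) (∫ ‖D²f‖²)` for a `C²` field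
with `f, D¹f, D²f ∈ L²` (Green, Cauchy–Schwarz, `‖Δf‖ ≤ 3 ‖D²f‖`). -/
theorem h1_interp_real {f : ℝ³ → ℝ³} (hf : ContDiff ℝ 2 f) (h0 : (∫⁻ x, ‖f x‖ₑ ^ 2) < ⊤)
    (h1 : (∫⁻ x, ‖iteratedFDeriv ℝ 1 f x‖ₑ ^ 2) < ⊤)
    (h2 : (∫⁻ x, ‖iteratedFDeriv ℝ 2 f x‖ₑ ^ 2) < ⊤) :
    (∫ x, frobeniusNormSq (fderiv ℝ f x)) ^ 2 ≤
      9 * (∫ x, ‖f x‖ ^ 2) * ∫ x, ‖iteratedFDeriv ℝ 2 f x‖ ^ 2 := by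
  have cf : Continuous f := hf.continuous
  have cΔ : Continuous (Δ f) := continuous_laplacian hf
  have cD2 : Continuous fun x => iteratedFDeriv ℝ 2 f x := hf.continuous_iteratedFDeriv le_rfl
  have l2Δ : (∫⁻ x, ‖(Δ f) x‖ₑ ^ 2) < ⊤ := h1_interp_lintegral_laplacian_lt_top hf h2
  -- integrability of the pairings
  have iΔf : Integrable (fun x => ⟪(Δ f) x, f x⟫) volume :=
    integrable_of_norm_le_mul_of_lintegral_sq (cΔ.inner cf).aestronglyMeasurable cΔ cf l2Δ h0
      fun x => norm_inner_le_norm _ _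
  have iprod : Integrable (fun x => ‖(Δ f) x‖ * ‖f x‖) volume :=
    integrable_of_norm_le_mul_of_lintegral_sq (cΔ.norm.mul cf.norm).aestronglyMeasurable cΔ cf
      l2Δ h0 fun x => by rw [Real.norm_of_nonneg (mul_nonneg (norm_nonneg _) (norm_nonneg _))]
  have iΔ2 : Integrable (fun x => ‖(Δ f) x‖ ^ 2) volume :=
    integrable_sq_norm_of_lintegral_lt_top cΔ l2Δ
  have iD2 : Integrable (fun x => ‖iteratedFDeriv ℝ 2 f x‖ ^ 2) volume :=
    integrable_sq_norm_of_lintegral_lt_top cD2 h2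
  have mΔ : MemLp (Δ f) 2 volume :=
    ⟨cΔ.aestronglyMeasurable, eLpNorm_two_lt_top_of_lintegral_enorm_sq_lt_top l2Δ⟩
  have mf : MemLp f 2 volume :=
    ⟨cf.aestronglyMeasurable, eLpNorm_two_lt_top_of_lintegral_enorm_sq_lt_top h0⟩
  -- the four integrals, as genuine variables
  obtain ⟨G, hG⟩ : ∃ G : ℝ, G = ∫ x, frobeniusNormSq (fderiv ℝ f x) := ⟨_, rfl⟩
  obtain ⟨A, hA⟩ : ∃ A : ℝ, A = ∫ x, ‖(Δ f) x‖ ^ 2 := ⟨_, rfl⟩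
  obtain ⟨B, hB⟩ : ∃ B : ℝ, B = ∫ x, ‖f x‖ ^ 2 := ⟨_, rfl⟩
  obtain ⟨C, hC⟩ : ∃ C : ℝ, C = ∫ x, ‖iteratedFDeriv ℝ 2 f x‖ ^ 2 := ⟨_, rfl⟩
  have hG0 : 0 ≤ G := by rw [hG]; exact integral_nonneg fun x => frobeniusNormSq_nonneg _
  have hA0 : 0 ≤ A := by rw [hA]; exact integral_nonneg fun x => sq_nonneg _
  have hB0 : 0 ≤ B := by rw [hB]; exact integral_nonneg fun x => sq_nonneg _
  -- `G = -∫ ⟪Δf, f⟫ ≤ ∫ ‖Δf‖ ‖f‖ ≤ √A √B`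
  have hGle : G ≤ Real.sqrt A * Real.sqrt B := by
    have hGI : G ≤ ∫ x, ‖(Δ f) x‖ * ‖f x‖ := by
      rw [hG, h1_interp_green hf h0 h1 h2, ← integral_neg]
      exact integral_mono iΔf.neg iprod fun x =>
        (neg_le_abs _).trans (abs_real_inner_le_norm _ _)
    rw [hA, hB]
    exact hGI.trans (integral_norm_mul_norm_le_sqrt_mul_sqrt mΔ mf)
  -- `A ≤ 9 C`
  have hAC : A ≤ 9 * C := by
    rw [hA, hC, ← integral_const_mul]
    refine integral_mono iΔ2 (iD2.const_mul 9) fun x => ?_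
    have h := norm_laplacian_le_three_mul_norm_iteratedFDeriv_two hf x
    dsimp only
    nlinarith [h, norm_nonneg ((Δ f) x)]
  rw [← hG, ← hB, ← hC]
  calc G ^ 2 ≤ (Real.sqrt A * Real.sqrt B) ^ 2 := pow_le_pow_left₀ hG0 hGle 2
    _ = A * B := by rw [mul_pow, Real.sq_sqrt hA0, Real.sq_sqrt hB0]
    _ ≤ 9 * C * B := mul_le_mul_of_nonneg_right hAC hB0
    _ = 9 * B * C := by ring

/-- **The `H¹` interpolation inequality** (stub `stub_h1_interp` of the line
`compact-amplification`): there is an absolute `K ≥ 0` (`K = 9`) such that every `C²` field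
`f : ℝ³ → ℝ³` with `f, D¹f, D²f ∈ L²` satisfies `(∫ |∇f|²)² ≤ K (∫ ‖f‖²) (∫ ‖D²f‖²)`
(`∫ |∇f|² = -∫ ⟪Δf, f⟫ ≤ ‖f‖₂ ‖Δf‖₂ ≤ 3 ‖f‖₂ ‖D²f‖₂`, squared, and transported to `[0, ∞]`). -/
theorem stub_h1_interp :
    ∃ K : ℝ, 0 ≤ K ∧ ∀ f : ℝ³ → ℝ³, ContDiff ℝ 2 f → (∫⁻ x, ‖f x‖ₑ ^ 2) < ⊤ →
      (∫⁻ x, ‖iteratedFDeriv ℝ 1 f x‖ₑ ^ 2) < ⊤ → (∫⁻ x, ‖iteratedFDeriv ℝ 2 f x‖ₑ ^ 2) < ⊤ →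
      (∫⁻ x, ENNReal.ofReal (frobeniusNormSq (fderiv ℝ f x))) ^ 2 ≤
        ENNReal.ofReal K * (∫⁻ x, ‖f x‖ₑ ^ 2) * (∫⁻ x, ‖iteratedFDeriv ℝ 2 f x‖ₑ ^ 2) := by
  refine ⟨9, by norm_num, fun f hf h0 h1 h2 => ?_⟩
  have cf : Continuous f := hf.continuous
  have cD2 : Continuous fun x => iteratedFDeriv ℝ 2 f x := hf.continuous_iteratedFDeriv le_rfl
  -- `∫⁻ |∇f|² = ofReal (∫ |∇f|²)`
  have l2Df : (∫⁻ x, ‖fderiv ℝ f x‖ₑ ^ 2) < ⊤ := by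
    refine lintegral_enorm_sq_lt_top_of_norm_le (fun x => le_of_eq ?_) h1
    rw [← norm_iteratedFDeriv_fderiv, norm_iteratedFDeriv_zero]
  have ifrob : Integrable (fun x => frobeniusNormSq (fderiv ℝ f x)) volume := by
    have hlt : (∫⁻ x, ENNReal.ofReal (frobeniusNormSq (fderiv ℝ f x))) < ⊤ :=
      calc ∫⁻ x, ENNReal.ofReal (frobeniusNormSq (fderiv ℝ f x))
          ≤ ∫⁻ x, 3 * ‖fderiv ℝ f x‖ₑ ^ 2 :=
            lintegral_mono fun x => ofReal_frobeniusNormSq_le_three_mul_enorm_sq _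
        _ = 3 * ∫⁻ x, ‖fderiv ℝ f x‖ₑ ^ 2 := lintegral_const_mul' _ _ (by norm_num)
        _ < ⊤ := ENNReal.mul_lt_top (by norm_num) l2Df
    exact integrable_of_continuous_of_nonneg (continuous_frobeniusNormSq_fderiv hf (by simp))
      (fun x => frobeniusNormSq_nonneg _) hlt
  have hF : (∫⁻ x, ENNReal.ofReal (frobeniusNormSq (fderiv ℝ f x))) =
      ENNReal.ofReal (∫ x, frobeniusNormSq (fderiv ℝ f x)) :=
    (ofReal_integral_eq_lintegral_ofReal ifrob
      (Eventually.of_forall fun x => frobeniusNormSq_nonneg _)).symm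
  -- `∫⁻ ‖f‖ₑ² = ofReal (∫ ‖f‖²)`, `∫⁻ ‖D²f‖ₑ² = ofReal (∫ ‖D²f‖²)`
  have hB : (∫⁻ x, ‖f x‖ₑ ^ 2) = ENNReal.ofReal (∫ x, ‖f x‖ ^ 2) :=
    (ofReal_integral_sq_norm (integrable_sq_norm_of_lintegral_lt_top cf h0)).symm
  have hC : (∫⁻ x, ‖iteratedFDeriv ℝ 2 f x‖ₑ ^ 2) =
      ENNReal.ofReal (∫ x, ‖iteratedFDeriv ℝ 2 f x‖ ^ 2) :=
    (ofReal_integral_sq_norm (integrable_sq_norm_of_lintegral_lt_top cD2 h2)).symm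
  have hG0 : 0 ≤ ∫ x, frobeniusNormSq (fderiv ℝ f x) :=
    integral_nonneg fun x => frobeniusNormSq_nonneg _
  have hB0 : 0 ≤ ∫ x, ‖f x‖ ^ 2 := integral_nonneg fun x => sq_nonneg _
  have h9 : (0 : ℝ) ≤ 9 := by norm_num
  have h9B : (0 : ℝ) ≤ 9 * ∫ x, ‖f x‖ ^ 2 := mul_nonneg h9 hB0
  rw [hF, hB, hC, ← ENNReal.ofReal_pow hG0, ← ENNReal.ofReal_mul h9, ← ENNReal.ofReal_mul h9B]
  exact ENNReal.ofReal_le_ofReal (h1_interp_real hf h0 h1 h2)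

end Summit.NavierStokesRegularity.NavierStokesRegularity.Theorems.CertifiedBlowupAxisymBlowup.CompactAmplification

end
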